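import Literature.Geometry.Lorentzian.InverseMeanCurvatureFlowApproxCompactness
import Literature.Geometry.Lorentzian.InverseMeanCurvatureFlowRegularised
import Literature.Geometry.Lorentzian.InverseMeanCurvatureFlowGradientLipschitz
import HarnessLib

/-!
# Inverse mean curvature flow I — proofs: limits of solutions of the elliptic regularisation
# are weak solutions

The passage to the limit `ε → 0` in Huisken–Ilmanen's proof of the Weak Existence Theorem 3.1
(J. Differential Geom. 59 (2001), §3, p. 26–27), in the form assembled from this series of files:
if `uᵢ` are classical solutions of the regularised equations (⋆)_{εᵢ},
`div(∇uᵢ/√(|∇uᵢ|² + εᵢ²)) = √(|∇uᵢ|² + εᵢ²)` on open sets `Ωᵢ` exhausting the open set `Ω`,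
with `εᵢ → 0`, locally uniform gradient bounds `|∇uᵢ| ≤ C` near every point of `Ω` (Lemma 3.4,
(3.9)) and `uᵢ → u` locally uniformly on `Ω` (Arzelà–Ascoli), then `u` is a weak solution of
(1.5) on `Ω` (`isWeakSolution_of_regularised_limit`):

* each `uᵢ` is an `εᵢ`-approximate weak solution on `Ωᵢ` (`imcfEnergy_le_add_of_regularised`,
  the calibration by `∇uᵢ/√(|∇uᵢ|² + εᵢ²)`, replacing the translating solutions `uᵢ − εᵢ z` on
  `M × ℝ` and Lemma 2.3 of loc. cit.);
* gradient bounds give equi-Lipschitz bounds for the Riemannian distance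
  (`exists_nhds_subset_forall_lipschitzOnWith_of_gradNorm_le`);
* the Compactness Theorem 2.1 for approximately minimising sequences
  (`isWeakSolution_of_tendstoLocallyUniformlyOn_of_approx`).

What remains of the proof of Thm. 3.1 beyond this file is the existence of the `uᵢ` with these
estimates (Lemmas 3.4–3.5: elliptic theory) and the assembly of the initial value problem.

Everything is proved; there are no definitions and no named facts.

## References

* G. Huisken, T. Ilmanen, *The inverse mean curvature flow and the Riemannian Penrose
  inequality*, J. Differential Geom. 59 (2001) 353–437: §3, (⋆)_ε, Lemma 3.4, proof of Thm. 3.1.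
-/

noncomputable section

open Bundle Set Manifold TopologicalSpace Filter MeasureTheory Function
open scoped ContDiff Topology ENNReal NNReal Manifold Real

namespace Literature.Geometry.Lorentzian

open PseudoRiemannianMetric

variable {X : Type*} [TopologicalSpace X] [ChartedSpace E3 X] [IsManifold (𝓡 3) ∞ X]
  (h : ContMDiffRiemannianMetric (𝓡 3) ∞ E3 (TangentSpace (𝓡 3) : X → Type _))
  [T2Space X] [LocallyCompactSpace X] [MeasurableSpace X] [BorelSpace X]
  [SecondCountableTopology X] [(ofRiemannian h).HasLeviCivita]

set_option backward.isDefEq.respectTransparency false in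
/-- **Limits of solutions of the elliptic regularisation are weak solutions** (the passage
`ε → 0` of Huisken–Ilmanen's proof of Thm. 3.1, p. 26–27, assembled). Let `Ω` and the `Ωᵢ` be
open, every compact `K ⊆ Ω` lying in `Ωᵢ` for large `i`; let `uᵢ ∈ C²(X)` solve the regularised
equation (⋆)_{εᵢ} classically on `Ωᵢ` (expanded form `ψᵢ Δuᵢ − h⁻¹(dψᵢ, duᵢ) = ψᵢ³`,
`ψᵢ = √(|∇uᵢ|² + εᵢ²) ∈ C¹(Ωᵢ)`), with `εᵢ > 0`, `εᵢ → 0`; suppose every point of `Ω` has a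
neighbourhood on which `|∇uᵢ| ≤ C` for large `i`, and `uᵢ → u` locally uniformly on `Ω`. Then `u` is
a weak solution of (1.5) on `Ω`. [cite: HuiskenIlmanenIMCF2001, §3 proof of Thm. 3.1 (ε → 0)] -/
theorem isWeakSolution_of_regularised_limit {u : ℕ → X → ℝ} {U : X → ℝ} {Ωs : ℕ → Set X}
    {Ω : Set X} {ε : ℕ → ℝ} {ψ : ℕ → X → ℝ} (hΩ : IsOpen Ω) (hΩo : ∀ i, IsOpen (Ωs i))
    (hu : ∀ i, ContMDiff (𝓡 3) 𝓘(ℝ, ℝ) 2 (u i)) (hε : ∀ i, 0 < ε i)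
    (hε0 : Tendsto ε atTop (𝓝 0))
    (hψ : ∀ i x, ψ i x = Real.sqrt (gradNorm h (u i) x ^ 2 + ε i ^ 2))
    (hψ1 : ∀ i, ContMDiffOn (𝓡 3) 𝓘(ℝ, ℝ) 1 (ψ i) (Ωs i))
    (hpde : ∀ i, ∀ x ∈ Ωs i, ψ i x * (ofRiemannian h).dalembertian (u i) x -
      (ofRiemannian h).innerDual x (mvfderiv (𝓡 3) (ψ i) x).toLinearMap
        (mvfderiv (𝓡 3) (u i) x).toLinearMap = ψ i x ^ 3)
    (hnest : ∀ K, IsCompact K → K ⊆ Ω → ∀ᶠ i in atTop, K ⊆ Ωs i)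
    (hconv : TendstoLocallyUniformlyOn u U atTop Ω)
    (hgrad : ∀ x ∈ Ω, ∃ C : ℝ≥0, ∃ V ∈ 𝓝 x, ∀ᶠ i in atTop, ∀ q ∈ V, gradNorm h (u i) q ≤ C) :
    IsWeakSolution h U Ω := by
  letI : RiemannianBundle (fun x : X ↦ TangentSpace (𝓡 3) x) :=
    ⟨h.toContinuousRiemannianMetric.toRiemannianMetric⟩
  letI : PseudoEMetricSpace X := .ofRiemannianMetric (𝓡 3) X
  -- the `uᵢ` are locally Lipschitz and `εᵢ`-approximately minimising on `Ωᵢ`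
  have hul : ∀ i, IsLocLipschitzOn h (u i) (Ωs i) := fun i ↦
    isLocLipschitzOn_of_contMDiff' h ((hu i).of_le (by norm_num)) (Ωs i)
  have happrox : ∀ i, ∀ w, IsCompetitor h (u i) (Ωs i) w → ∀ K, IsCompact K → K ⊆ Ωs i →
      {x | x ∈ Ωs i ∧ w x ≠ u i x} ⊆ K → imcfEnergy h (u i) K (u i) ≤ imcfEnergy h (u i) K w +
        ε i * ((riemannianMeasure h).real K + ∫ x in K, |w x - u i x| ∂riemannianMeasure h) :=
    fun i w hw K hK hKΩ hwK ↦
      imcfEnergy_le_add_of_regularised h (hΩo i) (hu i) (hε i) (hψ i) (hψ1 i) (hpde i) hw.1 hK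
        hKΩ hwK
  -- gradient bounds give equi-Lipschitz bounds
  have hlip : ∀ x ∈ Ω, ∃ K : ℝ≥0, ∃ V ∈ 𝓝 x, ∀ᶠ i in atTop, LipschitzOnWith K (u i) V := by
    intro x hx
    obtain ⟨C, V, hV, hC⟩ := hgrad x hx
    obtain ⟨W, hW, hWV, c, hc⟩ := exists_nhds_subset_forall_lipschitzOnWith_of_gradNorm_le h x hV
    refine ⟨C * c, W, hW, ?_⟩
    filter_upwards [hC] with i hi
    exact hc (u i) C (fun q _ ↦ ((hu i).of_le (by norm_num)).mdifferentiableAt one_ne_zero)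
      fun q hq ↦ hi q (hWV hq)
  exact isWeakSolution_of_tendstoLocallyUniformlyOn_of_approx h hΩ hΩo hul (fun i ↦ (hε i).le) hε0
    happrox hnest hconv hlip

end Literature.Geometry.Lorentzian

end
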